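import Mathlib
import HarnessLib
import Literature.Probability.ImportanceSampling.ChatterjeeDiaconis
import Summits.Ventures.LatticeQCDFlow.Exactness.NCMCGeneralSpaceRelativeEntropy

/-!
# NCMCGeneralSpaceKishSampleSize — Chatterjee–Diaconis for the SECOND MOMENT of the Jarzynski
# weights of a Crooks pair on a general state space: the sample second moment `(1/N)Σᵢ e^{−2W(εᵢ)}`
# (the Kish ESS denominator) needs `N ≈ exp KL(P₂ ‖ P_F)` independent forward records, `P₂` the
# forward record law tilted by `−2W`

HONEST FRAMING: exact (Metropolis-corrected) sampling algorithms for lattice gauge theory;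
figures of merit are autocorrelation/cost numbers at stated couplings and volumes; no
continuum-physics claim.

Venture `LatticeQCDFlow` (cell pub-lqcd); FANOUT row 19 (`su2-snf`, GEN-7), next to row 13's
`Exactness/NCMCGeneralSpace*` series.  A DOCKING file (nothing cited as a fact, nothing re-proved):
the Literature's Chatterjee–Diaconis theorem (`ImportanceSampling/ChatterjeeDiaconis`, Thm 1.1,
proved there) with proposal `μ = P_F = fwdPathLaw ν₀ κF` and target the DOUBLY-TILTED record law
`P₂ = P_F.tilted (−2W)` (Mathlib's `Measure.tilted`: density `e^{−2W}/E_{P_F}[e^{−2W}]`), for which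
the importance-sampling estimate `I_N(1)` of the Literature is the sample second moment of the
Jarzynski weights RELATIVE to its population value, `(1/N)Σᵢ e^{−2W(εᵢ)} / E_{P_F}[e^{−2W}]`
(`P_F^{⊗N}`-a.s.).  The finite path-space version with the exponent spelled as
`log ÊSS + 2(ΔF − ⟨W⟩₂)` is this seat's `Scaling/KishSampleSize`; the first-moment (Jarzynski /
reweighting) law is `Exactness/NCMCGeneralSpaceSampleSize`.

* `rnDeriv_sqTilt_ae` — `dP₂/dP_F = e^{−2W}/E_{P_F}[e^{−2W}]` `P_F`-a.e. (Mathlib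
  `rnDeriv_tilted_left_self`); `ae_pi_rnDeriv_sqTilt_eq`;
* `integral_log_rnDeriv_sqTilt` — the Literature's exponent is
  `L₂ = ∫ (−2W − log E_{P_F}[e^{−2W}]) dP₂` (`= KL(P₂ ‖ P_F)`);
* **`kish_sampleSize_necessary`** — `t ≥ 0`, `N ≤ e^{L₂ − t}`, `δ ∈ (0,1)` ⇒
  `P_F^{⊗N}{ (1/N)Σᵢ e^{−2W(εᵢ)}/E_{P_F}[e^{−2W}] ≥ 1 − δ } ≤ e^{−t/2} + P₂{−2W − log E_{P_F}[e^{−2W}] ≤ L₂ − t/2}/(1 − δ)`: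
  with fewer than `≈ e^{L₂}` INDEPENDENT forward records the sample second moment under-shoots
  `(1 − δ)×` its population value except on that event — the printed Kish fraction, whose
  denominator it is, is then over-optimistic;
* **`kish_sampleSize_sufficient`** — `N ≥ e^{L₂ + t}` ⇒
  `E|(1/N)Σᵢ e^{−2W(εᵢ)}/E_{P_F}[e^{−2W}] − 1| ≤ e^{−t/4} + 2√(P₂{L₂ + t/2 < −2W − log E_{P_F}[e^{−2W}]})`.

Hypothesis throughout: `e^{−2W} ∈ L¹(P_F)` (finite second moment of the weights, i.e. population
ESS `> 0`), so that `P₂` is a probability law (`isProbabilityMeasure_tilted`).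
NOT CLAIMED: the sample Kish fraction itself (a ratio of two sample means); correlated records;
any value of `L₂` for a concrete protocol.
-/

namespace Summit.Ventures.LatticeQCDFlow.Exactness.GeneralNCMC

open MeasureTheory ProbabilityTheory Set Filter
open scoped ENNReal
open Literature.Probability.ImportanceSampling (isEstimate ChatterjeeDiaconis2018_sampleSize_holds)

variable {Ω E : Type*} [MeasurableSpace Ω] [MeasurableSpace E]

namespace CrooksPair

variable {ν₀ ν₁ : Measure Ω} {κF κR : Kernel Ω E} {s e : E → Ω} {W : E → ℝ}

/-- **`dP₂/dP_F = e^{−2W}/E_{P_F}[e^{−2W}]`, `P_F`-almost everywhere**, for the doubly-tilted record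
law `P₂ = P_F.tilted (−2W)`. -/
theorem rnDeriv_sqTilt_ae [IsFiniteMeasure ν₀] [IsMarkovKernel κF] (h0 : ν₀ univ ≠ 0)
    (h : CrooksPair ν₀ ν₁ κF κR s e W) :
    ((fwdPathLaw ν₀ κF).tilted fun ε => -(2 * W ε)).rnDeriv (fwdPathLaw ν₀ κF)
      =ᵐ[fwdPathLaw ν₀ κF] fun ε => ENNReal.ofReal
        (Real.exp (-(2 * W ε)) / ∫ ε', Real.exp (-(2 * W ε')) ∂(fwdPathLaw ν₀ κF)) := by
  haveI := isProbabilityMeasure_fwdPathLaw ν₀ h0 κF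
  have hW := h.measurable_W
  exact rnDeriv_tilted_left_self (by fun_prop)

/-- On `P_F^{⊗N}`, almost surely every coordinate's `P₂`-density is
`e^{−2W(εᵢ)}/E_{P_F}[e^{−2W}]`. -/
theorem ae_pi_rnDeriv_sqTilt_eq [IsFiniteMeasure ν₀] [IsMarkovKernel κF] (h0 : ν₀ univ ≠ 0)
    (h : CrooksPair ν₀ ν₁ κF κR s e W) (N : ℕ) :
    ∀ᵐ x ∂(Measure.pi fun _ : Fin N => fwdPathLaw ν₀ κF), ∀ i : Fin N,
      (((fwdPathLaw ν₀ κF).tilted fun ε => -(2 * W ε)).rnDeriv (fwdPathLaw ν₀ κF) (x i)).toReal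
        = Real.exp (-(2 * W (x i))) / ∫ ε', Real.exp (-(2 * W ε')) ∂(fwdPathLaw ν₀ κF) := by
  haveI := isProbabilityMeasure_fwdPathLaw ν₀ h0 κF
  rw [ae_all_iff]
  intro i
  have hq := (measurePreserving_eval (fun _ : Fin N => fwdPathLaw ν₀ κF) i).quasiMeasurePreserving
  filter_upwards [hq.ae_eq (h.rnDeriv_sqTilt_ae h0)] with x hx
  have hx' : ((fwdPathLaw ν₀ κF).tilted fun ε => -(2 * W ε)).rnDeriv (fwdPathLaw ν₀ κF) (x i)
      = ENNReal.ofReal (Real.exp (-(2 * W (x i)))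
          / ∫ ε', Real.exp (-(2 * W ε')) ∂(fwdPathLaw ν₀ κF)) := hx
  rw [hx', ENNReal.toReal_ofReal (div_nonneg (Real.exp_pos _).le
    (integral_nonneg fun _ => (Real.exp_pos _).le))]

/-- The Literature's exponent for the target `P₂`: `∫ log(dP₂/dP_F) dP₂ = ∫ (−2W − log E_{P_F}[e^{−2W}]) dP₂`
(`= KL(P₂ ‖ P_F)`; the log-density is transported from `P_F`-a.e. to `P₂`-a.e. by `P₂ ≪ P_F`). -/
theorem integral_log_rnDeriv_sqTilt [IsFiniteMeasure ν₀] [IsMarkovKernel κF] (h0 : ν₀ univ ≠ 0)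
    (hint : Integrable (fun ε => Real.exp (-(2 * W ε))) (fwdPathLaw ν₀ κF)) :
    ∫ ε, Real.log (((fwdPathLaw ν₀ κF).tilted fun ε => -(2 * W ε)).rnDeriv (fwdPathLaw ν₀ κF)
        ε).toReal ∂((fwdPathLaw ν₀ κF).tilted fun ε => -(2 * W ε))
      = ∫ ε, (-(2 * W ε) - Real.log (∫ ε', Real.exp (-(2 * W ε')) ∂(fwdPathLaw ν₀ κF)))
          ∂((fwdPathLaw ν₀ κF).tilted fun ε => -(2 * W ε)) := by
  haveI := isProbabilityMeasure_fwdPathLaw ν₀ h0 κF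
  refine integral_congr_ae ?_
  exact (tilted_absolutelyContinuous _ _).ae_eq (log_rnDeriv_tilted_left_self hint)

/-- **KISH DENOMINATOR, NECESSITY (general state space).**  `e^{−2W} ∈ L¹(P_F)`, `t ≥ 0`,
`N ≤ e^{L₂ − t}` with `L₂ = ∫ (−2W − log E_{P_F}[e^{−2W}]) dP₂ = KL(P₂ ‖ P_F)`, `δ ∈ (0, 1)` ⇒
`P_F^{⊗N}{ (1/N)Σᵢ e^{−2W(εᵢ)}/E_{P_F}[e^{−2W}] ≥ 1 − δ } ≤ e^{−t/2} + P₂{−2W − log E_{P_F}[e^{−2W}] ≤ L₂ − t/2}/(1 − δ)`. -/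
theorem kish_sampleSize_necessary [IsFiniteMeasure ν₀] [IsMarkovKernel κF] (h0 : ν₀ univ ≠ 0)
    (h : CrooksPair ν₀ ν₁ κF κR s e W)
    (hint : Integrable (fun ε => Real.exp (-(2 * W ε))) (fwdPathLaw ν₀ κF))
    {t : ℝ} (ht : 0 ≤ t) {N : ℕ}
    (hN : (N : ℝ) ≤ Real.exp ((∫ ε, (-(2 * W ε)
        - Real.log (∫ ε', Real.exp (-(2 * W ε')) ∂(fwdPathLaw ν₀ κF)))
          ∂((fwdPathLaw ν₀ κF).tilted fun ε => -(2 * W ε))) - t))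
    {δ : ℝ} (hδ0 : 0 < δ) (hδ1 : δ < 1) :
    ((Measure.pi fun _ : Fin N => fwdPathLaw ν₀ κF)
        {x | 1 - δ ≤ (1 / (N : ℝ)) * ∑ i, Real.exp (-(2 * W (x i)))
          / ∫ ε', Real.exp (-(2 * W ε')) ∂(fwdPathLaw ν₀ κF)}).toReal
      ≤ Real.exp (-t / 2)
        + (((fwdPathLaw ν₀ κF).tilted fun ε => -(2 * W ε))
            {ε | -(2 * W ε) - Real.log (∫ ε', Real.exp (-(2 * W ε')) ∂(fwdPathLaw ν₀ κF))
              ≤ (∫ ε, (-(2 * W ε) - Real.log (∫ ε', Real.exp (-(2 * W ε')) ∂(fwdPathLaw ν₀ κF)))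
                  ∂((fwdPathLaw ν₀ κF).tilted fun ε => -(2 * W ε))) - t / 2}).toReal
          / (1 - δ) := by
  haveI := isProbabilityMeasure_fwdPathLaw ν₀ h0 κF
  haveI : IsProbabilityMeasure ((fwdPathLaw ν₀ κF).tilted fun ε => -(2 * W ε)) :=
    isProbabilityMeasure_tilted hint
  have hCD := (ChatterjeeDiaconis2018_sampleSize_holds E (fwdPathLaw ν₀ κF)
    ((fwdPathLaw ν₀ κF).tilted fun ε => -(2 * W ε)) (tilted_absolutelyContinuous _ _)
    (fun _ => (1 : ℝ)) measurable_const (memLp_const 1) t ht).2 N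
  rw [integral_log_rnDeriv_sqTilt h0 hint] at hCD
  have hmain := hCD hN δ hδ0 hδ1
  have hev : {x : Fin N → E | 1 - δ ≤ isEstimate (fwdPathLaw ν₀ κF)
        ((fwdPathLaw ν₀ κF).tilted fun ε => -(2 * W ε)) (fun _ => (1 : ℝ)) N x}
      =ᵐ[Measure.pi fun _ : Fin N => fwdPathLaw ν₀ κF]
        ({x : Fin N → E | 1 - δ ≤ (1 / (N : ℝ)) * ∑ i, Real.exp (-(2 * W (x i)))
          / ∫ ε', Real.exp (-(2 * W ε')) ∂(fwdPathLaw ν₀ κF)} : Set _) := by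
    filter_upwards [h.ae_pi_rnDeriv_sqTilt_eq h0 N] with x hx
    simp only [eq_iff_iff]
    dsimp only [setOf]
    simp only [isEstimate, one_mul]
    rw [Finset.sum_congr rfl fun i _ => hx i]
  have htail : {ε | Real.log (((fwdPathLaw ν₀ κF).tilted fun ε => -(2 * W ε)).rnDeriv
        (fwdPathLaw ν₀ κF) ε).toReal
        ≤ (∫ ε, (-(2 * W ε) - Real.log (∫ ε', Real.exp (-(2 * W ε')) ∂(fwdPathLaw ν₀ κF)))
            ∂((fwdPathLaw ν₀ κF).tilted fun ε => -(2 * W ε))) - t / 2}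
      =ᵐ[(fwdPathLaw ν₀ κF).tilted fun ε => -(2 * W ε)]
        ({ε | -(2 * W ε) - Real.log (∫ ε', Real.exp (-(2 * W ε')) ∂(fwdPathLaw ν₀ κF))
          ≤ (∫ ε, (-(2 * W ε) - Real.log (∫ ε', Real.exp (-(2 * W ε')) ∂(fwdPathLaw ν₀ κF)))
              ∂((fwdPathLaw ν₀ κF).tilted fun ε => -(2 * W ε))) - t / 2} : Set E) := by
    filter_upwards [(tilted_absolutelyContinuous _ _).ae_eq
      (log_rnDeriv_tilted_left_self hint)] with ε hε
    simp only [eq_iff_iff]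
    dsimp only [setOf]
    rw [hε]
  rw [measure_congr hev, measure_congr htail] at hmain
  exact hmain

/-- **KISH DENOMINATOR, SUFFICIENCY (general state space).**  `e^{−2W} ∈ L¹(P_F)`, `t ≥ 0`,
`N ≥ e^{L₂ + t}` ⇒ `E|(1/N)Σᵢ e^{−2W(εᵢ)}/E_{P_F}[e^{−2W}] − 1| ≤ e^{−t/4} + 2√(P₂{L₂ + t/2 < −2W − log E_{P_F}[e^{−2W}]})`:
the sample second moment of the weights estimates its population value to that relative accuracy. -/
theorem kish_sampleSize_sufficient [IsFiniteMeasure ν₀] [IsMarkovKernel κF] (h0 : ν₀ univ ≠ 0)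
    (h : CrooksPair ν₀ ν₁ κF κR s e W)
    (hint : Integrable (fun ε => Real.exp (-(2 * W ε))) (fwdPathLaw ν₀ κF))
    {t : ℝ} (ht : 0 ≤ t) {N : ℕ}
    (hN : Real.exp ((∫ ε, (-(2 * W ε)
        - Real.log (∫ ε', Real.exp (-(2 * W ε')) ∂(fwdPathLaw ν₀ κF)))
          ∂((fwdPathLaw ν₀ κF).tilted fun ε => -(2 * W ε))) + t) ≤ N) :
    ∫ x, |(1 / (N : ℝ)) * ∑ i, Real.exp (-(2 * W (x i)))
          / ∫ ε', Real.exp (-(2 * W ε')) ∂(fwdPathLaw ν₀ κF) - 1|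
        ∂(Measure.pi fun _ : Fin N => fwdPathLaw ν₀ κF)
      ≤ Real.exp (-t / 4) + 2 * Real.sqrt (((fwdPathLaw ν₀ κF).tilted fun ε => -(2 * W ε))
          {ε | (∫ ε, (-(2 * W ε) - Real.log (∫ ε', Real.exp (-(2 * W ε')) ∂(fwdPathLaw ν₀ κF)))
              ∂((fwdPathLaw ν₀ κF).tilted fun ε => -(2 * W ε))) + t / 2
            < -(2 * W ε) - Real.log (∫ ε', Real.exp (-(2 * W ε')) ∂(fwdPathLaw ν₀ κF))}).toReal := by
  haveI := isProbabilityMeasure_fwdPathLaw ν₀ h0 κF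
  haveI : IsProbabilityMeasure ((fwdPathLaw ν₀ κF).tilted fun ε => -(2 * W ε)) :=
    isProbabilityMeasure_tilted hint
  have hCD := (ChatterjeeDiaconis2018_sampleSize_holds E (fwdPathLaw ν₀ κF)
    ((fwdPathLaw ν₀ κF).tilted fun ε => -(2 * W ε)) (tilted_absolutelyContinuous _ _)
    (fun _ => (1 : ℝ)) measurable_const (memLp_const 1) t ht).1 N
  rw [integral_log_rnDeriv_sqTilt h0 hint] at hCD
  have hmain := hCD hN
  simp only [one_pow, integral_const, probReal_univ, smul_eq_mul, mul_one, Real.sqrt_one,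
    one_mul] at hmain
  have hint' : (fun x : Fin N → E => |isEstimate (fwdPathLaw ν₀ κF)
        ((fwdPathLaw ν₀ κF).tilted fun ε => -(2 * W ε)) (fun _ => (1 : ℝ)) N x - 1|)
      =ᵐ[Measure.pi fun _ : Fin N => fwdPathLaw ν₀ κF]
        fun x => |(1 / (N : ℝ)) * ∑ i, Real.exp (-(2 * W (x i)))
          / ∫ ε', Real.exp (-(2 * W ε')) ∂(fwdPathLaw ν₀ κF) - 1| := by
    filter_upwards [h.ae_pi_rnDeriv_sqTilt_eq h0 N] with x hx
    simp only [isEstimate, one_mul]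
    rw [Finset.sum_congr rfl fun i _ => hx i]
  have htail : {ε | (∫ ε, (-(2 * W ε) - Real.log (∫ ε', Real.exp (-(2 * W ε')) ∂(fwdPathLaw ν₀ κF)))
        ∂((fwdPathLaw ν₀ κF).tilted fun ε => -(2 * W ε))) + t / 2
        < Real.log (((fwdPathLaw ν₀ κF).tilted fun ε => -(2 * W ε)).rnDeriv
          (fwdPathLaw ν₀ κF) ε).toReal}
      =ᵐ[(fwdPathLaw ν₀ κF).tilted fun ε => -(2 * W ε)]
        ({ε | (∫ ε, (-(2 * W ε) - Real.log (∫ ε', Real.exp (-(2 * W ε')) ∂(fwdPathLaw ν₀ κF)))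
            ∂((fwdPathLaw ν₀ κF).tilted fun ε => -(2 * W ε))) + t / 2
          < -(2 * W ε) - Real.log (∫ ε', Real.exp (-(2 * W ε')) ∂(fwdPathLaw ν₀ κF))} : Set E) := by
    filter_upwards [(tilted_absolutelyContinuous _ _).ae_eq
      (log_rnDeriv_tilted_left_self hint)] with ε hε
    simp only [eq_iff_iff]
    dsimp only [setOf]
    rw [hε]
  rw [integral_congr_ae hint', measure_congr htail] at hmain
  exact hmain

end CrooksPair

end Summit.Ventures.LatticeQCDFlow.Exactness.GeneralNCMC

/-! ## §A (GEN-8 append) The Kish exponent is at most the FOURTH-MOMENT ratio: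
## `L₂ ≤ log(E_{P_F}e^{−4W}/(E_{P_F}e^{−2W})²)`, so `N ≥ e^{t}·E_F e^{−4W}/(E_F e^{−2W})²` records suffice

The exponent `L₂ = KL(P₂ ‖ P_F) = E_{P₂}[log ρ₂]`, `ρ₂ = dP₂/dP_F = e^{−2W}/E_F e^{−2W}`, is bounded by
`log E_{P₂}[ρ₂] = log E_F[ρ₂²]` (the tangent line `log x ≤ log M + x/M − 1` integrated against the
probability measure `P₂` — Jensen for the concave `log`; when `log ρ₂ ∉ L¹(P₂)` the typed exponent is
`0 ≤ log E_F[ρ₂²]` by `E_F[ρ₂²] ≥ (E_F ρ₂)² = 1`).  In the Gaussian work model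
(`Scaling/GaussianWorkSampleSize`) this reads `2s ≤ 4s`: a one-sided, moment-level certificate of the
Kish sample size that needs no knowledge of `P₂`. -/

namespace Summit.Ventures.LatticeQCDFlow.Exactness.GeneralNCMC

namespace CrooksPair

open MeasureTheory ProbabilityTheory Set Filter
open scoped ENNReal

variable {Ω E : Type*} [MeasurableSpace Ω] [MeasurableSpace E]
variable {ν₀ ν₁ : Measure Ω} {κF κR : Kernel Ω E} {s e : E → Ω} {W : E → ℝ}

/-- **`KL(P₂ ‖ P_F) ≤ log(E_F e^{−4W}/(E_F e^{−2W})²)`** — the Kish sample-size exponent is at most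
the log of the fourth-moment ratio of the Jarzynski weights (`e^{−2W}, e^{−4W} ∈ L¹(P_F)`). -/
theorem kishExponent_le_log_fourthMoment [IsFiniteMeasure ν₀] [IsMarkovKernel κF] (h0 : ν₀ univ ≠ 0)
    (h : CrooksPair ν₀ ν₁ κF κR s e W)
    (hint : Integrable (fun ε => Real.exp (-(2 * W ε))) (fwdPathLaw ν₀ κF))
    (hint4 : Integrable (fun ε => Real.exp (-(4 * W ε))) (fwdPathLaw ν₀ κF)) :
    ∫ ε, (-(2 * W ε) - Real.log (∫ ε', Real.exp (-(2 * W ε')) ∂(fwdPathLaw ν₀ κF)))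
        ∂((fwdPathLaw ν₀ κF).tilted fun ε => -(2 * W ε))
      ≤ Real.log ((∫ ε, Real.exp (-(4 * W ε)) ∂(fwdPathLaw ν₀ κF))
          / (∫ ε, Real.exp (-(2 * W ε)) ∂(fwdPathLaw ν₀ κF)) ^ 2) := by
  haveI := isProbabilityMeasure_fwdPathLaw ν₀ h0 κF
  set P := fwdPathLaw ν₀ κF with hP
  set Z : ℝ := ∫ ε, Real.exp (-(2 * W ε)) ∂P with hZ
  set M4 : ℝ := ∫ ε, Real.exp (-(4 * W ε)) ∂P with hM4
  have hW := h.measurable_W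
  have hZpos : 0 < Z := by rw [hZ]; exact integral_exp_pos hint
  haveI : IsProbabilityMeasure (P.tilted fun ε => -(2 * W ε)) := isProbabilityMeasure_tilted hint
  have hsq : ∀ ε, Real.exp (-(2 * W ε)) * Real.exp (-(2 * W ε)) = Real.exp (-(4 * W ε)) := by
    intro ε; rw [← Real.exp_add]; congr 1; ring
  -- `M = M4/Z² ≥ 1` (Cauchy–Schwarz: `Z² = (E e^{−2W})² ≤ E e^{−4W}`)
  set M : ℝ := M4 / Z ^ 2 with hM
  have hL2 : MemLp (fun ε => Real.exp (-(2 * W ε))) 2 P := by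
    rw [memLp_two_iff_integrable_sq hint.aestronglyMeasurable]
    refine hint4.congr (Eventually.of_forall fun ε => ?_)
    simp only [sq]; exact (hsq ε).symm
  have hM4ge : Z ^ 2 ≤ M4 := by
    have hv := variance_nonneg (fun ε => Real.exp (-(2 * W ε))) P
    rw [variance_eq_sub hL2] at hv
    have h2 : ∫ ε, ((fun ε => Real.exp (-(2 * W ε))) ^ 2) ε ∂P = M4 := by
      rw [hM4]; exact integral_congr_ae (Eventually.of_forall fun ε => by
        simp only [Pi.pow_apply, sq]; exact hsq ε)
    rw [h2] at hv
    have h3 : (∫ ε, (fun ε => Real.exp (-(2 * W ε))) ε ∂P) = Z := rfl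
    rw [h3] at hv
    linarith
  have hMpos : 0 < M := div_pos (lt_of_lt_of_le (pow_pos hZpos 2) hM4ge) (pow_pos hZpos 2)
  have hM1 : 1 ≤ M := by rw [hM, le_div_iff₀ (pow_pos hZpos 2), one_mul]; exact hM4ge
  -- the density `ρ₂ = e^{−2W}/Z`; the exponent's integrand is `log ρ₂`
  set ρ : E → ℝ := fun ε => Real.exp (-(2 * W ε)) / Z with hρ
  have hρpos : ∀ ε, 0 < ρ ε := fun ε => div_pos (Real.exp_pos _) hZpos
  have hρm : Measurable ρ := (Real.measurable_exp.comp ((hW.const_mul 2).neg)).div_const Z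
  have hlog : ∀ ε, -(2 * W ε) - Real.log Z = Real.log (ρ ε) := by
    intro ε
    rw [hρ]
    simp only
    rw [Real.log_div (Real.exp_pos _).ne' hZpos.ne', Real.log_exp]
  simp_rw [hlog]
  -- `∫ ρ dP₂ = M4/Z² = M`
  have hmean : ∫ ε, ρ ε ∂(P.tilted fun ε => -(2 * W ε)) = M := by
    rw [integral_tilted]
    have : ∀ ε, (Real.exp (-(2 * W ε)) / ∫ ε', Real.exp (-(2 * W ε')) ∂P) • ρ ε
        = (1 / Z ^ 2) * Real.exp (-(4 * W ε)) := by
      intro ε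
      rw [smul_eq_mul, hρ, ← hZ]
      simp only
      rw [← hsq ε]
      field_simp
    simp_rw [this]
    rw [integral_const_mul, ← hM4, hM]
    field_simp
  -- `ρ ∈ L¹(P₂)` (density form of the tilted measure)
  have hρint : Integrable ρ (P.tilted fun ε => -(2 * W ε)) := by
    have hd : Measurable fun ε => ENNReal.ofReal (Real.exp (-(2 * W ε)) / ∫ ε', Real.exp (-(2 * W ε')) ∂P) :=
      ((Real.measurable_exp.comp ((hW.const_mul 2).neg)).div_const _).ennreal_ofReal
    rw [Measure.tilted, integrable_withDensity_iff_integrable_smul₀' hd.aemeasurable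
      (Eventually.of_forall fun _ => ENNReal.ofReal_lt_top)]
    have hi : Integrable (fun ε => (1 / Z ^ 2) * Real.exp (-(4 * W ε))) P := hint4.const_mul _
    refine hi.congr (Eventually.of_forall fun ε => ?_)
    simp only
    rw [ENNReal.toReal_ofReal (div_nonneg (Real.exp_pos _).le hZpos.le), smul_eq_mul]
    simp only [hρ]
    rw [← hsq ε]
    field_simp
  -- case split on the integrability of `log ρ` under `P₂`
  by_cases hli : Integrable (fun ε => Real.log (ρ ε)) (P.tilted fun ε => -(2 * W ε))
  · have hpt : ∀ ε, Real.log (ρ ε) ≤ Real.log M + (ρ ε / M - 1) := by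
      intro ε
      have h1 := Real.log_le_sub_one_of_pos (div_pos (hρpos ε) hMpos)
      rw [Real.log_div (hρpos ε).ne' hMpos.ne'] at h1
      linarith
    have hri : Integrable (fun ε => Real.log M + (ρ ε / M - 1)) (P.tilted fun ε => -(2 * W ε)) :=
      (integrable_const _).add ((hρint.div_const M).sub (integrable_const _))
    calc ∫ ε, Real.log (ρ ε) ∂(P.tilted fun ε => -(2 * W ε))
        ≤ ∫ ε, (Real.log M + (ρ ε / M - 1)) ∂(P.tilted fun ε => -(2 * W ε)) :=
          integral_mono hli hri hpt
      _ = Real.log M := by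
          have h1 : Integrable (fun ε => ρ ε / M) (P.tilted fun ε => -(2 * W ε)) :=
            hρint.div_const M
          have h2 : Integrable (fun ε => ρ ε / M - 1) (P.tilted fun ε => -(2 * W ε)) :=
            h1.sub (integrable_const _)
          rw [integral_add (integrable_const _) h2, integral_sub h1 (integrable_const _),
            integral_div, hmean, integral_const, integral_const, probReal_univ, one_smul, one_smul,
            div_self hMpos.ne']
          ring
  · rw [integral_undef hli]
    exact Real.log_nonneg hM1

/-- **KISH DENOMINATOR, SUFFICIENCY FROM THE FOURTH MOMENT.**  `e^{−2W}, e^{−4W} ∈ L¹(P_F)`, `t ≥ 0`,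
`N ≥ e^{t}·E_F e^{−4W}/(E_F e^{−2W})²` independent forward records ⇒ the sample second moment of the
weights estimates its population value with
`E|(1/N)Σᵢ e^{−2W(εᵢ)}/E_F e^{−2W} − 1| ≤ e^{−t/4} + 2√(P₂{L₂ + t/2 < log ρ₂})` — the printed Kish
fraction is then trustworthy in the sense of `kish_sampleSize_sufficient`, certified from two
moments of the run's own weights. -/
theorem kish_sampleSize_sufficient_of_fourthMoment [IsFiniteMeasure ν₀] [IsMarkovKernel κF]
    (h0 : ν₀ univ ≠ 0) (h : CrooksPair ν₀ ν₁ κF κR s e W)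
    (hint : Integrable (fun ε => Real.exp (-(2 * W ε))) (fwdPathLaw ν₀ κF))
    (hint4 : Integrable (fun ε => Real.exp (-(4 * W ε))) (fwdPathLaw ν₀ κF))
    {t : ℝ} (ht : 0 ≤ t) {N : ℕ}
    (hN : Real.exp t * ((∫ ε, Real.exp (-(4 * W ε)) ∂(fwdPathLaw ν₀ κF))
          / (∫ ε, Real.exp (-(2 * W ε)) ∂(fwdPathLaw ν₀ κF)) ^ 2) ≤ N) :
    ∫ x, |(1 / (N : ℝ)) * ∑ i, Real.exp (-(2 * W (x i)))
          / ∫ ε', Real.exp (-(2 * W ε')) ∂(fwdPathLaw ν₀ κF) - 1|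
        ∂(Measure.pi fun _ : Fin N => fwdPathLaw ν₀ κF)
      ≤ Real.exp (-t / 4) + 2 * Real.sqrt (((fwdPathLaw ν₀ κF).tilted fun ε => -(2 * W ε))
          {ε | (∫ ε, (-(2 * W ε) - Real.log (∫ ε', Real.exp (-(2 * W ε')) ∂(fwdPathLaw ν₀ κF)))
              ∂((fwdPathLaw ν₀ κF).tilted fun ε => -(2 * W ε))) + t / 2
            < -(2 * W ε) - Real.log (∫ ε', Real.exp (-(2 * W ε')) ∂(fwdPathLaw ν₀ κF))}).toReal := by
  haveI := isProbabilityMeasure_fwdPathLaw ν₀ h0 κF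
  refine h.kish_sampleSize_sufficient h0 hint ht (le_trans ?_ hN)
  have hb := h.kishExponent_le_log_fourthMoment h0 hint hint4
  have hZpos : 0 < ∫ ε, Real.exp (-(2 * W ε)) ∂(fwdPathLaw ν₀ κF) := integral_exp_pos hint
  have hM4pos : 0 < ∫ ε, Real.exp (-(4 * W ε)) ∂(fwdPathLaw ν₀ κF) := integral_exp_pos hint4
  have hMpos : 0 < (∫ ε, Real.exp (-(4 * W ε)) ∂(fwdPathLaw ν₀ κF))
      / (∫ ε, Real.exp (-(2 * W ε)) ∂(fwdPathLaw ν₀ κF)) ^ 2 := div_pos hM4pos (pow_pos hZpos 2)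
  calc Real.exp ((∫ ε, (-(2 * W ε) - Real.log (∫ ε', Real.exp (-(2 * W ε')) ∂(fwdPathLaw ν₀ κF)))
          ∂((fwdPathLaw ν₀ κF).tilted fun ε => -(2 * W ε))) + t)
      ≤ Real.exp (Real.log ((∫ ε, Real.exp (-(4 * W ε)) ∂(fwdPathLaw ν₀ κF))
          / (∫ ε, Real.exp (-(2 * W ε)) ∂(fwdPathLaw ν₀ κF)) ^ 2) + t) :=
        Real.exp_le_exp.mpr (by linarith)
    _ = Real.exp t * ((∫ ε, Real.exp (-(4 * W ε)) ∂(fwdPathLaw ν₀ κF))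
          / (∫ ε, Real.exp (-(2 * W ε)) ∂(fwdPathLaw ν₀ κF)) ^ 2) := by
        rw [Real.exp_add, Real.exp_log hMpos, mul_comm]

end CrooksPair

end Summit.Ventures.LatticeQCDFlow.Exactness.GeneralNCMC
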